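import Literature.NumberTheory.LFunctions.ZetaArgRHExplicit
import Mathlib.Analysis.SpecialFunctions.Log.Basic
import HarnessLib

/-!
# RH-CONDITIONAL — Carneiro–Chandee–Milinovich: `|S(t)| ≤ (¼ + o(1)) log t/log log t` and the two-sided bound for `S₁(t)` under RH («nothing here bears on the truth of RH»)

Topic `Literature/NumberTheory/LFunctions` (RH literature-typing tranche 1, L4 "explicit zero
statistics"; companion of `ZetaArgRHExplicit.lean`, which holds Simonič's numerically explicit
RH-conditional bounds with the weaker leading constants `0.759…`/`0.653`). Label:
**RH-CONDITIONAL** — both facts have the shape `RiemannHypothesis → …`; they are published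
theorems ("Assume RH. For `t` sufficiently large …") vendored as NAMED FACTS (`def … : Prop`,
D-0014; nothing is asserted, users take `(h : …)` and feed it RH). Nothing here bears on the
truth of RH.

Source: E. Carneiro, V. Chandee, M. B. Milinovich, *Bounding `S(t)` and `S₁(t)` on the Riemann
hypothesis*, Math. Ann. **356** (2013) 939–968 (arXiv:1309.1526; Zbl 1325.11084), typed from the
arXiv TeX source, Theorems 1 and 2 of §1:

* `CarneiroChandeeMilinovich2013_thm1` — **Theorem 1**: on RH, for `t` sufficiently large,
  `|S(t)| ≤ ¼ log t/log log t + O(log t · log log log t/(log log t)²)` — the admissible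
  Littlewood constant `C₀ = ¼` (Goldston–Gonek 2007: `½`; Fujii: `0.67`;
  Ramachandra–Sankaranarayanan: `1.119`), by the Beurling–Selberg extremal functions for the odd
  function `arctan(1/x) − x/(1+x²)` and the Guinand–Weil explicit formula;
* `CarneiroChandeeMilinovich2013_thm2` — **Theorem 2**: on RH, for `t` sufficiently large,
  `−(π/24 + o(1)) log t/(log log t)² ≤ S₁(t) ≤ (π/48 + o(1)) log t/(log log t)²`, where both
  `o(1)` are `O(log log log t/log log t)` (extremal functions for `1 − x arctan(1/x)`).

## Conventions (as in `ZetaArgRHExplicit.lean`)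

* `S(t)` is the tree's `zetaArgS` (Backlund's right-continuous form `N(T) − θ(T)/π − 1`); the
  source's `S(t)` is the same off the ordinates and the average of the one-sided limits at an
  ordinate. Since the typed bounds are of the form "`∃ C t₀, ∀ t ≥ t₀, |S(t)| ≤ B_C(t)`" with
  `B_C` continuous, they are EQUIVALENT for the two conventions (one-sided limits obey the same
  bound). `S₁(t) = ∫₀ᵗ S(u) du` is `∫ u in (0:ℝ)..t, zetaArgS u`.
* "For `t` sufficiently large … `+ O(E(t))`" / "`o(1) = O(log log log t/log log t)`" are rendered
  by an explicit pair `∃ C t₀` (ineffective as printed): the error is `≤ C · E(t)` for `t ≥ t₀`.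
  For `t ≥ t₀` large, `log log log t > 0`, so the sign of the error term is the printed one.

Proved here (no new hypotheses): `CarneiroChandeeMilinovich2013_thm1.littlewood` — Theorem 1 ⇒
the Littlewood form with constant `¼`: on RH, for every `ε > 0`, `|S(t)| ≤ (¼ + ε) log t/log log t`
for all large `t` (since `log log log t/log log t → 0`); and the analogous
`CarneiroChandeeMilinovich2013_thm2.littlewood` (`|S₁(t)| ≤ (π/24 + ε) log t/(log log t)²`).
What is deliberately NOT here: the extremal-function machinery (§§2–3, 5), the bound (1.4) for
`S(t+h) − S(t)`, and the later refinements for `S_n(t)`, `n ≥ 2` (Carneiro–Chirre–Milinovich).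

## References

* E. Carneiro, V. Chandee, M. B. Milinovich, Math. Ann. 356 (2013) 939–968, Thms. 1–2
  (arXiv:1309.1526). [CarneiroChandeeMilinovich2013]
* A. Simonič, J. Number Theory 231 (2022) 464–491 (the explicit versions with weaker constants,
  `ZetaArgRHExplicit.lean`). [Simonic2022]
* E. C. Titchmarsh, *The Theory of the Riemann Zeta-Function*, 2nd ed., Thm. 14.13 (Littlewood's
  RH bounds for `S`, `S₁`). [Titchmarsh1986]
-/

noncomputable section

open Real Filter Topology MeasureTheory intervalIntegral

namespace Literature.NumberTheory.LFunctions

/-! ## The named facts -/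

/-- NAMED FACT, RH-CONDITIONAL (Carneiro–Chandee–Milinovich 2013, **Theorem 1**, as printed:
"Assume RH. For `t` sufficiently large we have
`|S(t)| ≤ ¼ log t/log log t + O(log t log log log t/(log log t)²)`."). The `O`-constant and the
threshold are rendered as an explicit (ineffective) pair `C, t₀`. `S = zetaArgS` (module docstring
for the convention at ordinates, under which this reading is equivalent to the printed one).
Users take `(h : CarneiroChandeeMilinovich2013_thm1)` and RH.
[cite: CarneiroChandeeMilinovich2013, Thm. 1] -/
def CarneiroChandeeMilinovich2013_thm1 : Prop :=
  RiemannHypothesis →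
    ∃ C t₀ : ℝ, ∀ t : ℝ, t₀ ≤ t →
      |zetaArgS t| ≤ 1 / 4 * Real.log t / Real.log (Real.log t)
        + C * (Real.log t * Real.log (Real.log (Real.log t)) / Real.log (Real.log t) ^ 2)

/-- NAMED FACT, RH-CONDITIONAL (Carneiro–Chandee–Milinovich 2013, **Theorem 2**, as printed:
"Assume RH. For `t` sufficiently large we have
`−(π/24 + o(1)) log t/(log log t)² ≤ S₁(t) ≤ (π/48 + o(1)) log t/(log log t)²`, where the terms
`o(1)` in the above inequalities are `O(log log log t/log log t)`."), `S₁(t) = ∫₀ᵗ S(u) du`. Both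
`o(1)`-terms are rendered by one explicit (ineffective) pair `C, t₀`:
`|o(1)| ≤ C log log log t/log log t` for `t ≥ t₀`. Users take
`(h : CarneiroChandeeMilinovich2013_thm2)` and RH. [cite: CarneiroChandeeMilinovich2013, Thm. 2] -/
def CarneiroChandeeMilinovich2013_thm2 : Prop :=
  RiemannHypothesis →
    ∃ C t₀ : ℝ, ∀ t : ℝ, t₀ ≤ t →
      -(π / 24 + C * (Real.log (Real.log (Real.log t)) / Real.log (Real.log t)))
            * (Real.log t / Real.log (Real.log t) ^ 2)
          ≤ ∫ u in (0 : ℝ)..t, zetaArgS u ∧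
        ∫ u in (0 : ℝ)..t, zetaArgS u ≤
          (π / 48 + C * (Real.log (Real.log (Real.log t)) / Real.log (Real.log t)))
            * (Real.log t / Real.log (Real.log t) ^ 2)

/-! ## Proved consequences: the Littlewood forms with constants `¼` and `π/24` -/

/-- `log log log t/log log t → 0` as `t → ∞`. [folklore] -/
private theorem tendsto_lll_div_ll :
    Tendsto (fun t : ℝ ↦ Real.log (Real.log (Real.log t)) / Real.log (Real.log t)) atTop (𝓝 0) := by
  have h1 : Tendsto (fun u : ℝ ↦ Real.log u / u) atTop (𝓝 0) :=
    Real.isLittleO_log_id_atTop.tendsto_div_nhds_zero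
  have h2 : Tendsto (fun t : ℝ ↦ Real.log (Real.log t)) atTop atTop :=
    Real.tendsto_log_atTop.comp Real.tendsto_log_atTop
  exact h1.comp h2

namespace CarneiroChandeeMilinovich2013_thm1

/-- Theorem 1 ⇒ Littlewood's bound with the constant `C₀ = ¼`: on RH, for every `ε > 0` there is
`t₁` with `|S(t)| ≤ (¼ + ε) log t/log log t` for all `t ≥ t₁`.
[cite: CarneiroChandeeMilinovich2013, Thm. 1] -/
theorem littlewood (h : CarneiroChandeeMilinovich2013_thm1) (hRH : RiemannHypothesis) {ε : ℝ}
    (hε : 0 < ε) :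
    ∃ t₁ : ℝ, ∀ t : ℝ, t₁ ≤ t →
      |zetaArgS t| ≤ (1 / 4 + ε) * Real.log t / Real.log (Real.log t) := by
  obtain ⟨C, t₀, hC⟩ := h hRH
  -- eventually `|C| · lll t/ll t ≤ ε` and `log log t > 0`
  have hev1 : ∀ᶠ t : ℝ in atTop,
      |C| * (Real.log (Real.log (Real.log t)) / Real.log (Real.log t)) ≤ ε := by
    have ht := (tendsto_lll_div_ll.const_mul |C|)
    rw [mul_zero] at ht
    exact (ht.eventually (ge_mem_nhds hε)).mono fun t ht ↦ ht
  have hev2 : ∀ᶠ t : ℝ in atTop, Real.exp (Real.exp 1) < t := eventually_gt_atTop _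
  have hev3 : ∀ᶠ t : ℝ in atTop, t₀ ≤ t := eventually_ge_atTop _
  obtain ⟨t₁, ht₁⟩ := ((hev1.and hev2).and hev3).exists_forall_of_atTop
  refine ⟨t₁, fun t ht ↦ ?_⟩
  obtain ⟨⟨h1, h2⟩, h3⟩ := ht₁ t ht
  have ht0 : 0 < t := lt_trans (Real.exp_pos _) h2
  have hL : Real.exp 1 < Real.log t := by
    rw [← Real.exp_lt_exp, Real.exp_log ht0]; exact h2
  have hL0 : 0 < Real.log t := lt_trans (Real.exp_pos 1) hL
  have hLL : 1 < Real.log (Real.log t) := by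
    rw [← Real.exp_lt_exp, Real.exp_log hL0]; exact hL
  have hLL0 : 0 < Real.log (Real.log t) := by linarith
  have hb := hC t h3
  -- the error term is at most `ε log t/log log t`
  have herr : C * (Real.log t * Real.log (Real.log (Real.log t)) / Real.log (Real.log t) ^ 2) ≤
      ε * (Real.log t / Real.log (Real.log t)) := by
    have e : C * (Real.log t * Real.log (Real.log (Real.log t)) / Real.log (Real.log t) ^ 2) =
        (C * (Real.log (Real.log (Real.log t)) / Real.log (Real.log t))) *
          (Real.log t / Real.log (Real.log t)) := by
      field_simp
    rw [e]
    refine mul_le_mul_of_nonneg_right ?_ (div_nonneg hL0.le hLL0.le)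
    calc C * (Real.log (Real.log (Real.log t)) / Real.log (Real.log t))
        ≤ |C * (Real.log (Real.log (Real.log t)) / Real.log (Real.log t))| := le_abs_self _
      _ = |C| * |Real.log (Real.log (Real.log t)) / Real.log (Real.log t)| := abs_mul _ _
      _ ≤ ε := by
          have hq : 0 ≤ Real.log (Real.log (Real.log t)) / Real.log (Real.log t) :=
            div_nonneg (Real.log_nonneg hLL.le) hLL0.le
          rwa [abs_of_nonneg hq]
  calc |zetaArgS t| ≤ 1 / 4 * Real.log t / Real.log (Real.log t)
        + C * (Real.log t * Real.log (Real.log (Real.log t)) / Real.log (Real.log t) ^ 2) := hb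
    _ ≤ 1 / 4 * Real.log t / Real.log (Real.log t) + ε * (Real.log t / Real.log (Real.log t)) := by
        linarith
    _ = (1 / 4 + ε) * Real.log t / Real.log (Real.log t) := by ring

end CarneiroChandeeMilinovich2013_thm1

namespace CarneiroChandeeMilinovich2013_thm2

/-- Theorem 2 ⇒ Littlewood's bound for `S₁` with the constant `π/24`: on RH, for every `ε > 0`
there is `t₁` with `|S₁(t)| ≤ (π/24 + ε) log t/(log log t)²` for all `t ≥ t₁`.
[cite: CarneiroChandeeMilinovich2013, Thm. 2] -/
theorem littlewood (h : CarneiroChandeeMilinovich2013_thm2) (hRH : RiemannHypothesis) {ε : ℝ}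
    (hε : 0 < ε) :
    ∃ t₁ : ℝ, ∀ t : ℝ, t₁ ≤ t →
      |∫ u in (0 : ℝ)..t, zetaArgS u| ≤ (π / 24 + ε) * Real.log t / Real.log (Real.log t) ^ 2 := by
  obtain ⟨C, t₀, hC⟩ := h hRH
  have hev1 : ∀ᶠ t : ℝ in atTop,
      |C| * (Real.log (Real.log (Real.log t)) / Real.log (Real.log t)) ≤ ε := by
    have ht := (tendsto_lll_div_ll.const_mul |C|)
    rw [mul_zero] at ht
    exact (ht.eventually (ge_mem_nhds hε)).mono fun t ht ↦ ht
  have hev2 : ∀ᶠ t : ℝ in atTop, Real.exp (Real.exp 1) < t := eventually_gt_atTop _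
  have hev3 : ∀ᶠ t : ℝ in atTop, t₀ ≤ t := eventually_ge_atTop _
  obtain ⟨t₁, ht₁⟩ := ((hev1.and hev2).and hev3).exists_forall_of_atTop
  refine ⟨t₁, fun t ht ↦ ?_⟩
  obtain ⟨⟨h1, h2⟩, h3⟩ := ht₁ t ht
  have hπ : 0 < π := Real.pi_pos
  have ht0 : 0 < t := lt_trans (Real.exp_pos _) h2
  have hL : Real.exp 1 < Real.log t := by
    rw [← Real.exp_lt_exp, Real.exp_log ht0]; exact h2
  have hL0 : 0 < Real.log t := lt_trans (Real.exp_pos 1) hL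
  have hLL : 1 < Real.log (Real.log t) := by
    rw [← Real.exp_lt_exp, Real.exp_log hL0]; exact hL
  have hLL0 : 0 < Real.log (Real.log t) := by linarith
  obtain ⟨hlo, hhi⟩ := hC t h3
  have hq0 : 0 ≤ Real.log (Real.log (Real.log t)) / Real.log (Real.log t) :=
    div_nonneg (Real.log_nonneg hLL.le) hLL0.le
  have hCq : |C * (Real.log (Real.log (Real.log t)) / Real.log (Real.log t))| ≤ ε := by
    rw [abs_mul, abs_of_nonneg hq0]; exact h1
  have hCq1 := (abs_le.1 hCq).1
  have hCq2 := (abs_le.1 hCq).2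
  have hF : 0 ≤ Real.log t / Real.log (Real.log t) ^ 2 := by positivity
  rw [abs_le]
  constructor
  · -- lower bound: −(π/24 + ε) F ≤ −(π/24 + C q) F ≤ S₁
    have : -(π / 24 + ε) * (Real.log t / Real.log (Real.log t) ^ 2) ≤
        -(π / 24 + C * (Real.log (Real.log (Real.log t)) / Real.log (Real.log t))) *
          (Real.log t / Real.log (Real.log t) ^ 2) :=
      mul_le_mul_of_nonneg_right (by linarith) hF
    have e : -((π / 24 + ε) * Real.log t / Real.log (Real.log t) ^ 2) =
        -(π / 24 + ε) * (Real.log t / Real.log (Real.log t) ^ 2) := by ring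
    rw [e]
    exact this.trans hlo
  · -- upper bound: S₁ ≤ (π/48 + C q) F ≤ (π/24 + ε) F
    have : (π / 48 + C * (Real.log (Real.log (Real.log t)) / Real.log (Real.log t))) *
          (Real.log t / Real.log (Real.log t) ^ 2) ≤
        (π / 24 + ε) * (Real.log t / Real.log (Real.log t) ^ 2) :=
      mul_le_mul_of_nonneg_right (by linarith) hF
    have e : (π / 24 + ε) * Real.log t / Real.log (Real.log t) ^ 2 =
        (π / 24 + ε) * (Real.log t / Real.log (Real.log t) ^ 2) := by ring
    rw [e]
    exact hhi.trans this

end CarneiroChandeeMilinovich2013_thm2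

end Literature.NumberTheory.LFunctions

end
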